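import Literature.ModelTheory.ProofTheory.GodelCoding
import Literature.ModelTheory.ProofTheory.PreSemantics

/-!
# The set of Gödel numbers of sentences is decidable

Support file for the discharge of Janiczak's theorem
(`FirstOrder.Language.Theory.isDecidable_of_isComplete_of_isComputablyAxiomatizable`,
`Literature/ModelTheory/ExponentialFields/DecidableTheory.lean`), and more generally for every
statement that a first-order theory is *decidable* in the sense of `Theory.IsDecidable` /
`Theory.IsRecursive` of that file: those notions are about subsets of **all** natural numbers, so
any decision procedure must in particular reject the numbers that are not Gödel numbers of
sentences. We prove that this is possible (Enderton, *A Mathematical Introduction to Logic*,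
§3.4, items 3–6 of the arithmetization of syntax: "the set of terms / atomic formulas / wffs /
sentences is recursive"), for Mathlib's concrete Gödel numbering
`Sentence.godelNumber φ = encode (formulaLetters φ)` (`GodelCoding.lean`):

* `Literature.ModelTheory.ProofTheory.PreFOL.computablePred_exists_godelNumber_eq`: if the arity tables `arityF L`, `arityR L`
  of the symbol codes are computable (e.g. `L.IsRecursivelyPresented`, see
  `IsRecursivelyPresented.computable_arityF` in `DecidableTheoryProofs.lean`), then
  `{n | ∃ φ : L.Sentence, ⌜φ⌝ = n}` is a computable set.

## The recognisers

Mathlib's letters (`GodelCoding.lean`: `termLetters_var/func`, `formulaLetters_falsum/equal/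
rel/imp/all`) are Polish notation: a term at depth `k` is `4 i + 2` (`i < k`) or `2 f + 1`
followed by the letters of `arity f` arguments; a bounded formula at depth `k` is `4 k + 11`,
or two term letters `2 ⟨k, ⌜t⌝⟩` (an equation; `⌜t⌝` is the code of the letter list of `t`), or
`4 r + 1, 4 k + 3` followed by `arity r` term letters, or `3` followed by two formulas, or `7`
followed by a formula at depth `k + 1`.

* `termScan` — the classical counting scan of a Polish term string (state: number of pending
  terms); `termScan_termLetters` (scan law) and `exists_term_of_termScan` (unique reading);
  `isTermAtB_iff`: `isTermAtB (arityF L) k x ↔ ∃ t, x = 2 ⟨k, ⌜t⌝⟩`.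
* `parseF` — recursive descent with fuel for formula strings, returning the unread remainder;
  `parseF_formulaLetters` (completeness) and `exists_boundedFormula_of_parseF` (soundness /
  unique reading); `sentenceLettersB_iff`, `exists_godelNumber_eq_iff`.

## Computability

The recognisers take the arities as *oracles* `ℕ → Option ℕ`. For primitive recursiveness the
oracles are replaced by finite tables (`tab`), relative to which everything is primitive
recursive (`primrec_termScan`, …, `primrec_pF` — the recursive descent is a course-of-values
recursion on the fuel, `Primrec.nat_omega_rec'`, with the data-dependent second call of the
implication case over-approximated by all suffixes, `pCalls`/`pG_pCalls`); since the recognisers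
only consult the oracles below the letters read (`parseF_congr`), tabulating computable oracles
below the input (`arityTable`, `computable_arityTable`) gives a computable decision procedure
(`computable_sentenceLettersB`).

## References

* H. B. Enderton, *A Mathematical Introduction to Logic*, 2nd ed., Harcourt/Academic Press
  (2001), §3.4 (arithmetization of syntax, items 3–6).
* Mathlib, `Mathlib/ModelTheory/Encoding.lean` (the letters), `Mathlib/Computability/Primrec.lean`
  (`Primrec.nat_omega_rec'`).
-/

namespace Literature.ModelTheory.ProofTheory.PreFOL

open FirstOrder FirstOrder.Language Encodable Denumerable

/-! ### Recognising the letters of a term: the counting scan -/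

/-- One step of the counting scan of a Polish-notation term string at depth `k`, relative to an
arity oracle `o` for function-symbol codes. State `some (n + 1)`: `n + 1` terms remain to be
read; `some 0`: a complete term has been read (any further letter is an error); `none`: error.
A variable letter is `4 i + 2` with `i < k`; a function letter is `2 f + 1` with `o f = some a`. [folklore] -/
def termStep (o : ℕ → Option ℕ) (k : ℕ) : Option ℕ → ℕ → Option ℕ
  | none, _ => none
  | some 0, _ => none
  | some (n + 1), x =>
    if x % 4 = 2 ∧ x / 4 < k then some n
    else if x % 2 = 1 then (o (x / 2)).map (n + ·)
    else none

/-- The counting scan of a list of letters (a left fold of `termStep`). [folklore] -/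
def termScan (o : ℕ → Option ℕ) (k : ℕ) (l : List ℕ) (s : Option ℕ) : Option ℕ :=
  l.foldl (termStep o k) s

section TermScan

variable {o : ℕ → Option ℕ} {k : ℕ}

/-- Scanning no letters. [folklore] -/
@[simp] theorem termScan_nil (s : Option ℕ) : termScan o k [] s = s := rfl

/-- Scanning one more letter. [folklore] -/
theorem termScan_cons (x : ℕ) (l : List ℕ) (s : Option ℕ) :
    termScan o k (x :: l) s = termScan o k l (termStep o k s x) := rfl

/-- Scanning a concatenation. [folklore] -/
theorem termScan_append (l₁ l₂ : List ℕ) (s : Option ℕ) :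
    termScan o k (l₁ ++ l₂) s = termScan o k l₂ (termScan o k l₁ s) :=
  List.foldl_append

/-- The error state is absorbing. [folklore] -/
@[simp] theorem termScan_none (l : List ℕ) : termScan o k l none = none := by
  induction l with
  | nil => rfl
  | cons x l ih => rw [termScan_cons]; exact ih

/-- From the state "complete", only the empty string is accepted. [folklore] -/
theorem termScan_some_zero {l : List ℕ} {r : ℕ} (h : termScan o k l (some 0) = some r) :
    l = [] ∧ r = 0 := by
  cases l with
  | nil => simpa [eq_comm] using h
  | cons x l => rw [termScan_cons, termStep, termScan_none] at h; exact absurd h (by simp)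

end TermScan

section TermLetters

variable {L : Language} [Encodable (Σ i, L.Functions i)]

/-- Scanning the flattened letters of a tuple of terms, given the scan law for each. [folklore] -/
theorem termScan_flatten_ofFn {k : ℕ} :
    ∀ {a : ℕ} (ts : Fin a → L.Term (Empty ⊕ Fin k))
      (_ : ∀ i n rest, termScan (arityF L) k (termLetters (ts i) ++ rest) (some (n + 1)) =
        termScan (arityF L) k rest (some n))
      (n : ℕ) (rest : List ℕ),
      termScan (arityF L) k ((List.ofFn fun i => termLetters (ts i)).flatten ++ rest)
        (some (n + a)) = termScan (arityF L) k rest (some n)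
  | 0, _, _, n, rest => by simp
  | a + 1, ts, ih, n, rest => by
    rw [List.ofFn_succ, List.flatten_cons, List.append_assoc,
      show n + (a + 1) = (n + a) + 1 from by omega, ih 0 (n + a)]
    exact termScan_flatten_ofFn (fun i => ts i.succ) (fun i => ih i.succ) n rest

/-- **The scan law**: reading the letters of a term decrements the pending count. [folklore] -/
theorem termScan_termLetters {k : ℕ} (t : L.Term (Empty ⊕ Fin k)) :
    ∀ (n : ℕ) (rest : List ℕ),
      termScan (arityF L) k (termLetters t ++ rest) (some (n + 1)) =
        termScan (arityF L) k rest (some n) := by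
  induction t with
  | var v =>
    rcases v with e | i
    · exact e.elim
    · intro n rest
      rw [termLetters_var, List.singleton_append, termScan_cons, termStep]
      have h1 : (4 * i.val + 2) % 4 = 2 := by omega
      have h2 : (4 * i.val + 2) / 4 = i.val := by omega
      rw [if_pos ⟨h1, by rw [h2]; exact i.isLt⟩]
  | func F ts ih =>
    intro n rest
    rw [termLetters_func, List.cons_append, termScan_cons, termStep]
    set f := encode (⟨_, F⟩ : Σ i, L.Functions i) with hf
    have h1 : ¬ ((2 * f + 1) % 4 = 2 ∧ (2 * f + 1) / 4 < k) := fun h => by omega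
    have h2 : (2 * f + 1) % 2 = 1 := by omega
    have h3 : (2 * f + 1) / 2 = f := by omega
    rw [if_neg h1, if_pos h2, h3, hf, arityF_encode, Option.map_some]
    exact termScan_flatten_ofFn ts ih n rest

/-- **Unique reading**: a successful scan from pending count `n + 1` down to at most `n` has read
the letters of a term first. [folklore] -/
theorem exists_term_of_termScan {k : ℕ} :
    ∀ (N : ℕ) (l : List ℕ), l.length ≤ N → ∀ (n r : ℕ),
      termScan (arityF L) k l (some (n + 1)) = some r → r ≤ n →
      ∃ (t : L.Term (Empty ⊕ Fin k)) (rest : List ℕ),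
        l = termLetters t ++ rest ∧ termScan (arityF L) k rest (some n) = some r := by
  intro N
  induction N with
  | zero =>
    intro l hl n r h hr
    obtain rfl : l = [] := List.eq_nil_of_length_eq_zero (Nat.le_zero.1 hl)
    simp at h
    omega
  | succ N IH =>
    intro l hl n r h hr
    cases l with
    | nil => simp at h; omega
    | cons x l =>
      have hl' : l.length ≤ N := by simpa using hl
      rw [termScan_cons, termStep] at h
      by_cases h1 : x % 4 = 2 ∧ x / 4 < k
      · rw [if_pos h1] at h
        refine ⟨Term.var (Sum.inr ⟨x / 4, h1.2⟩), l, ?_, h⟩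
        rw [termLetters_var, List.singleton_append, Fin.val_mk]
        congr 1
        omega
      rw [if_neg h1] at h
      by_cases h2 : x % 2 = 1
      · rw [if_pos h2] at h
        cases ho : arityF L (x / 2) with
        | none => rw [ho, Option.map_none, termScan_none] at h; exact absurd h (by simp)
        | some a =>
          rw [ho, Option.map_some] at h
          -- peel `a` terms off `l`
          have peel : ∀ (b : ℕ) (m : List ℕ), m.length ≤ N → ∀ r', 
              termScan (arityF L) k m (some (n + b)) = some r' → r' ≤ n →
              ∃ (g : Fin b → L.Term (Empty ⊕ Fin k)) (rest : List ℕ),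
                m = (List.ofFn fun i => termLetters (g i)).flatten ++ rest ∧
                  termScan (arityF L) k rest (some n) = some r' := by
            intro b
            induction b with
            | zero => intro m _ r' hm _; exact ⟨Fin.elim0, m, by simp, by simpa using hm⟩
            | succ b ihb =>
              intro m hm r' h' hr'
              rw [show n + (b + 1) = (n + b) + 1 from by omega] at h'
              obtain ⟨t, rest₁, rfl, h₁⟩ := IH m hm (n + b) r' h' (by omega)
              have hlen : rest₁.length ≤ N := le_trans (by simp) hm
              obtain ⟨g, rest, rfl, h₂⟩ := ihb rest₁ hlen r' h₁ hr'
              refine ⟨Fin.cons t g, rest, ?_, h₂⟩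
              simp [List.ofFn_succ]
          obtain ⟨g, rest, rfl, hrest⟩ := peel a l hl' r h hr
          obtain ⟨F, hF⟩ := arityF_eq_some_iff.1 ho
          refine ⟨Term.func F g, rest, ?_, hrest⟩
          rw [termLetters_func, hF, List.cons_append]
          congr 1
          omega
      · rw [if_neg h2, termScan_none] at h
        exact absurd h (by simp)

end TermLetters

/-! ### Recognising term letters inside formulas -/

/-- `x` is the letter of a term at depth `k`: `x = 2 ⟨k, c⟩` with `c` the code of the letters of
a term (relative to the arity oracle `o`). [folklore] -/
def isTermAtB (o : ℕ → Option ℕ) (k x : ℕ) : Bool :=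
  decide (x % 2 = 0) && decide ((x / 2).unpair.1 = k) &&
    decide (termScan o k (ofNat (List ℕ) (x / 2).unpair.2) (some 1) = some 0)

/-- All entries of `l` are letters of terms at depth `k` (a left fold, for primitive recursion). [folklore] -/
def allTermAtB (o : ℕ → Option ℕ) (k : ℕ) (l : List ℕ) : Bool :=
  l.foldl (fun b z => b && isTermAtB o k z) true

/-- A left fold of `&&` computes `List.all`. [folklore] -/
theorem foldl_and_eq {α : Type*} (p : α → Bool) :
    ∀ (l : List α) (b : Bool), l.foldl (fun b z => b && p z) b = (b && l.all p)
  | [], b => by simp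
  | x :: l, b => by rw [List.foldl_cons, foldl_and_eq p l, List.all_cons, Bool.and_assoc]

/-- `allTermAtB` holds iff every entry is a term letter. [folklore] -/
theorem allTermAtB_eq_true {o : ℕ → Option ℕ} {k : ℕ} {l : List ℕ} :
    allTermAtB o k l = true ↔ ∀ z ∈ l, isTermAtB o k z = true := by
  rw [allTermAtB, foldl_and_eq, Bool.true_and, List.all_eq_true]

section IsTermAt

variable {L : Language} [Encodable (Σ i, L.Functions i)]

/-- Entries of a decoded list are smaller than its code. [folklore] -/
theorem lt_encode_of_mem {y : ℕ} : ∀ {l : List ℕ}, y ∈ l → y < encode l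
  | [], h => absurd h (by simp)
  | x :: l, h => by
    rw [encode_list_cons, encode_nat]
    rcases List.mem_cons.1 h with rfl | h
    · exact Nat.lt_succ_of_le (Nat.left_le_pair _ _)
    · exact lt_of_lt_of_le (lt_encode_of_mem h)
        (le_trans (Nat.right_le_pair _ _) (Nat.le_succ _))

/-- Entries of the list with code `c` are smaller than `c`. [folklore] -/
theorem lt_of_mem_ofNat {y c : ℕ} (h : y ∈ ofNat (List ℕ) c) : y < c := by
  simpa [encode_ofNat] using lt_encode_of_mem h

/-- **Correctness of `isTermAtB`** for the arity table of `L`. [folklore] -/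
theorem isTermAtB_iff {k x : ℕ} :
    isTermAtB (arityF L) k x = true ↔ ∃ t : L.Term (Empty ⊕ Fin k), x = 2 * Nat.pair k (encode t) := by
  simp only [isTermAtB, Bool.and_eq_true, decide_eq_true_eq]
  constructor
  · rintro ⟨⟨h0, h1⟩, h2⟩
    obtain ⟨t, rest, ht, hrest⟩ :=
      exists_term_of_termScan (L := L) _ _ le_rfl 0 0 h2 le_rfl
    obtain ⟨rfl, -⟩ := termScan_some_zero hrest
    rw [List.append_nil] at ht
    refine ⟨t, ?_⟩
    have hc : (x / 2).unpair.2 = encode t := by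
      rw [encode_term_eq, ← ht, encode_ofNat]
    subst h1
    rw [← hc, Nat.pair_unpair]
    omega
  · rintro ⟨t, rfl⟩
    have h2 : 2 * Nat.pair k (encode t) / 2 = Nat.pair k (encode t) := by omega
    refine ⟨⟨by omega, by rw [h2, Nat.unpair_pair]⟩, ?_⟩
    rw [h2, Nat.unpair_pair]
    dsimp only
    rw [ofNat_encode_term]
    simpa using termScan_termLetters t 0 []

end IsTermAt

/-! ### Recognising the letters of a bounded formula: recursive descent with fuel -/

/-- Recursive-descent recogniser of the letters of a bounded formula at depth `k` (fuel `f`),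
relative to arity oracles `oF`, `oR`: returns the unread remainder on success. Letters:
`4 k + 11` (falsum), `3` (implication, prefix), `7` (universal quantifier, prefix; the body is at
depth `k + 1`), two term letters (equation), `4 r + 1, 4 k + 3` followed by `a` term letters
(atomic relation with `oR r = some a`). [folklore] -/
def parseF (oF oR : ℕ → Option ℕ) : ℕ → ℕ → List ℕ → Option (List ℕ)
  | 0, _, _ => none
  | _ + 1, _, [] => none
  | f + 1, k, x :: t =>
    if x = 4 * k + 11 then some t
    else if x = 3 then (parseF oF oR f k t).bind fun m => parseF oF oR f k m
    else if x = 7 then parseF oF oR f (k + 1) t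
    else if x % 2 = 0 then
      match t with
      | [] => none
      | y :: t' => if isTermAtB oF k x = true ∧ isTermAtB oF k y = true then some t' else none
    else if x % 4 = 1 then
      (oR (x / 4)).bind fun a =>
        match t with
        | [] => none
        | y :: t' =>
          if y = 4 * k + 3 ∧ a ≤ t'.length ∧ allTermAtB oF k (t'.take a) = true then
            some (t'.drop a) else none
    else none

section ParseF

variable {oF oR : ℕ → Option ℕ}

/-- Without fuel the recogniser fails. [folklore] -/
@[simp] theorem parseF_zero (k : ℕ) (l : List ℕ) : parseF oF oR 0 k l = none := rfl
/-- On the empty string the recogniser fails. [folklore] -/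
@[simp] theorem parseF_nil (f k : ℕ) : parseF oF oR f k [] = none := by cases f <;> rfl

/-- The recursion equation of `parseF`. [folklore] -/
theorem parseF_succ_cons (f k x : ℕ) (t : List ℕ) :
    parseF oF oR (f + 1) k (x :: t) =
      if x = 4 * k + 11 then some t
      else if x = 3 then (parseF oF oR f k t).bind fun m => parseF oF oR f k m
      else if x = 7 then parseF oF oR f (k + 1) t
      else if x % 2 = 0 then
        match t with
        | [] => none
        | y :: t' => if isTermAtB oF k x = true ∧ isTermAtB oF k y = true then some t' else none
      else if x % 4 = 1 then
        (oR (x / 4)).bind fun a =>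
          match t with
          | [] => none
          | y :: t' =>
            if y = 4 * k + 3 ∧ a ≤ t'.length ∧ allTermAtB oF k (t'.take a) = true then
              some (t'.drop a) else none
      else none :=
  rfl

/-- The remainder returned by the recogniser is a suffix of the input. [folklore] -/
theorem suffix_of_parseF : ∀ (f k : ℕ) (l r : List ℕ), parseF oF oR f k l = some r → r <:+ l := by
  intro f
  induction f with
  | zero => intro k l r h; simp at h
  | succ f ih =>
    intro k l r h
    cases l with
    | nil => simp at h
    | cons x t =>
      rw [parseF_succ_cons] at h
      split_ifs at h with h1 h2 h3 h4 h5
      · cases h; exact List.suffix_cons _ _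
      · obtain ⟨m, hm, hmr⟩ := Option.bind_eq_some_iff.1 h
        exact ((ih k m r hmr).trans (ih k t m hm)).trans (List.suffix_cons _ _)
      · exact (ih (k + 1) t r h).trans (List.suffix_cons _ _)
      · cases t with
        | nil => exact absurd h (by simp)
        | cons y t' =>
          simp only at h
          split_ifs at h
          cases h
          exact ((List.suffix_cons _ _).trans (List.suffix_cons _ _))
      · obtain ⟨a, -, ha⟩ := Option.bind_eq_some_iff.1 h
        cases t with
        | nil => exact absurd ha (by simp)
        | cons y t' =>
          simp only at ha
          split_ifs at ha
          cases ha
          exact ((List.drop_suffix _ _).trans (List.suffix_cons _ _)).trans (List.suffix_cons _ _)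

end ParseF

/-- Taking the length of the first part of a concatenation. [folklore] -/
theorem take_append_of_length_eq {α : Type*} {l₁ : List α} (l₂ : List α) {n : ℕ}
    (h : l₁.length = n) : (l₁ ++ l₂).take n = l₁ := by
  subst h
  induction l₁ with
  | nil => simp
  | cons a l ih => simp [ih]

/-- Dropping the length of the first part of a concatenation. [folklore] -/
theorem drop_append_of_length_eq {α : Type*} {l₁ : List α} (l₂ : List α) {n : ℕ}
    (h : l₁.length = n) : (l₁ ++ l₂).drop n = l₂ := by
  subst h
  induction l₁ with
  | nil => simp
  | cons a l ih => simp [ih]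

section FormulaLetters

variable {L : Language} [Encodable (Σ i, L.Functions i)] [Encodable (Σ i, L.Relations i)]

/-- **Completeness of the recogniser**: with enough fuel, the letters of a bounded formula are
read off, leaving the remainder. [folklore] -/
theorem parseF_formulaLetters {k : ℕ} (φ : L.BoundedFormula Empty k) :
    ∀ (rest : List ℕ) (f : ℕ), (formulaLetters φ).length ≤ f →
      parseF (arityF L) (arityR L) f k (formulaLetters φ ++ rest) = some rest := by
  induction φ with
  | falsum =>
    intro rest f hf
    obtain ⟨f, rfl⟩ : ∃ f', f = f' + 1 := ⟨f - 1, by simp at hf; omega⟩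
    simp [parseF_succ_cons]
  | equal t₁ t₂ =>
    rename_i k
    intro rest f hf
    obtain ⟨f, rfl⟩ : ∃ f', f = f' + 1 := ⟨f - 1, by simp at hf; omega⟩
    rw [formulaLetters_equal]
    have h1 : 2 * Nat.pair k (encode t₁) ≠ 4 * k + 11 := by omega
    have h2 : 2 * Nat.pair k (encode t₁) ≠ 3 := by omega
    have h3 : 2 * Nat.pair k (encode t₁) ≠ 7 := by omega
    have h4 : 2 * Nat.pair k (encode t₁) % 2 = 0 := by omega
    have h5 : isTermAtB (arityF L) k (2 * Nat.pair k (encode t₁)) = true := isTermAtB_iff.2 ⟨t₁, rfl⟩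
    have h6 : isTermAtB (arityF L) k (2 * Nat.pair k (encode t₂)) = true := isTermAtB_iff.2 ⟨t₂, rfl⟩
    simp [parseF_succ_cons, h1, h2, h3, h4, h5, h6]
  | rel R ts =>
    rename_i k a
    intro rest f hf
    obtain ⟨f, rfl⟩ : ∃ f', f = f' + 1 := ⟨f - 1, by simp at hf; omega⟩
    rw [formulaLetters_rel]
    have h1 : 4 * encode (⟨a, R⟩ : Σ i, L.Relations i) + 1 ≠ 4 * k + 11 := by omega
    have h2 : 4 * encode (⟨a, R⟩ : Σ i, L.Relations i) + 1 ≠ 3 := by omega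
    have h3 : 4 * encode (⟨a, R⟩ : Σ i, L.Relations i) + 1 ≠ 7 := by omega
    have h4 : ¬ ((4 * encode (⟨a, R⟩ : Σ i, L.Relations i) + 1) % 2 = 0) := by omega
    have h5 : (4 * encode (⟨a, R⟩ : Σ i, L.Relations i) + 1) % 4 = 1 := by omega
    have h6 : (4 * encode (⟨a, R⟩ : Σ i, L.Relations i) + 1) / 4 =
        encode (⟨a, R⟩ : Σ i, L.Relations i) := by omega
    have hall : allTermAtB (arityF L) k
        (List.ofFn fun i => 2 * Nat.pair k (encode (ts i))) = true := by
      rw [allTermAtB_eq_true]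
      intro z hz
      obtain ⟨i, rfl⟩ := List.mem_ofFn.1 hz
      exact isTermAtB_iff.2 ⟨ts i, rfl⟩
    have htake : ((List.ofFn fun i => 2 * Nat.pair k (encode (ts i))) ++ rest).take a =
        List.ofFn fun i => 2 * Nat.pair k (encode (ts i)) :=
      take_append_of_length_eq rest (List.length_ofFn)
    have hdrop : ((List.ofFn fun i => 2 * Nat.pair k (encode (ts i))) ++ rest).drop a = rest :=
      drop_append_of_length_eq rest (List.length_ofFn)
    rw [List.cons_append, List.cons_append, parseF_succ_cons, if_neg h1, if_neg h2, if_neg h3,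
      if_neg h4, if_pos h5, h6, arityR_encode, Option.bind_some]
    dsimp only
    rw [if_pos ⟨rfl, by simp, by rw [htake]; exact hall⟩, hdrop]
  | imp φ ψ ihφ ihψ =>
    rename_i k
    intro rest f hf
    obtain ⟨f, rfl⟩ : ∃ f', f = f' + 1 := ⟨f - 1, by simp at hf; omega⟩
    rw [formulaLetters_imp, List.cons_append, parseF_succ_cons, if_neg (by omega), if_pos rfl,
      List.append_assoc, ihφ _ f (by simp at hf; omega), Option.bind_some,
      ihψ _ f (by simp at hf; omega)]
  | all φ ih =>
    rename_i k
    intro rest f hf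
    obtain ⟨f, rfl⟩ : ∃ f', f = f' + 1 := ⟨f - 1, by simp at hf; omega⟩
    rw [formulaLetters_all, List.cons_append, parseF_succ_cons, if_neg (by omega), if_neg (by omega),
      if_pos rfl, ih _ f (by simp at hf; omega)]

/-- **Soundness of the recogniser (unique reading)**: a successful run has read the letters of a
bounded formula of the given depth. [folklore] -/
theorem exists_boundedFormula_of_parseF :
    ∀ (f k : ℕ) (l r : List ℕ), parseF (arityF L) (arityR L) f k l = some r →
      ∃ φ : L.BoundedFormula Empty k, l = formulaLetters φ ++ r := by
  intro f
  induction f with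
  | zero => intro k l r h; simp at h
  | succ f ih =>
    intro k l r h
    cases l with
    | nil => simp at h
    | cons x t =>
      rw [parseF_succ_cons] at h
      split_ifs at h with h1 h2 h3 h4 h5
      · cases h
        exact ⟨BoundedFormula.falsum, by simp [h1]⟩
      · obtain ⟨m, hm, hmr⟩ := Option.bind_eq_some_iff.1 h
        obtain ⟨φ, rfl⟩ := ih k t m hm
        obtain ⟨ψ, rfl⟩ := ih k m r hmr
        exact ⟨φ.imp ψ, by simp [h2]⟩
      · obtain ⟨φ, rfl⟩ := ih (k + 1) t r h
        exact ⟨φ.all, by simp [h3]⟩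
      · cases t with
        | nil => exact absurd h (by simp)
        | cons y t' =>
          simp only at h
          split_ifs at h with hc
          cases h
          obtain ⟨t₁, rfl⟩ := isTermAtB_iff.1 hc.1
          obtain ⟨t₂, rfl⟩ := isTermAtB_iff.1 hc.2
          exact ⟨BoundedFormula.equal t₁ t₂, by simp⟩
      · obtain ⟨a, ha, h⟩ := Option.bind_eq_some_iff.1 h
        obtain ⟨R, hR⟩ := arityR_eq_some_iff.1 ha
        cases t with
        | nil => exact absurd h (by simp)
        | cons y t' =>
          simp only at h
          split_ifs at h with hc
          cases h
          obtain ⟨hy, hlen, hall⟩ := hc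
          rw [allTermAtB_eq_true] at hall
          have hz : ∀ i : Fin a, ∃ s : L.Term (Empty ⊕ Fin k),
              (t'.take a)[i.val]'(by simp; omega) = 2 * Nat.pair k (encode s) := fun i =>
            isTermAtB_iff.1 (hall _ (List.getElem_mem _))
          choose ts hts using hz
          refine ⟨BoundedFormula.rel R ts, ?_⟩
          rw [formulaLetters_rel, hR, List.cons_append, List.cons_append]
          have hx : 4 * (x / 4) + 1 = x := by omega
          rw [hx, hy]
          congr 2
          have hofn : (List.ofFn fun i => 2 * Nat.pair k (encode (ts i))) = t'.take a := by
            apply List.ext_getElem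
            · simp; omega
            · intro i hi₁ hi₂
              rw [List.getElem_ofFn]
              exact (hts ⟨i, by simpa using hi₁⟩).symm
          rw [hofn, List.take_append_drop]

/-- The recogniser of sentence letter strings. [folklore] -/
def sentenceLettersB (oF oR : ℕ → Option ℕ) (l : List ℕ) : Bool :=
  decide (parseF oF oR (l.length + 1) 0 l = some [])

/-- **Correctness**: `sentenceLettersB` accepts exactly the letter strings of sentences. [folklore] -/
theorem sentenceLettersB_iff {l : List ℕ} :
    sentenceLettersB (arityF L) (arityR L) l = true ↔ ∃ φ : L.Sentence, formulaLetters φ = l := by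
  rw [sentenceLettersB, decide_eq_true_eq]
  constructor
  · intro h
    obtain ⟨φ, hφ⟩ := exists_boundedFormula_of_parseF _ _ _ _ h
    exact ⟨φ, by rw [hφ, List.append_nil]⟩
  · rintro ⟨φ, rfl⟩
    simpa using parseF_formulaLetters φ [] ((formulaLetters φ).length + 1) (by omega)

/-- **Correctness on Gödel numbers**: `n` is the Gödel number of a sentence iff the recogniser
accepts the list decoded from `n`. [folklore] -/
theorem exists_godelNumber_eq_iff (n : ℕ) :
    (∃ φ : L.Sentence, φ.godelNumber = n) ↔
      sentenceLettersB (arityF L) (arityR L) (ofNat (List ℕ) n) = true := by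
  rw [sentenceLettersB_iff]
  constructor
  · rintro ⟨φ, rfl⟩
    exact ⟨φ, by rw [godelNumber_eq, ofNat_encode]⟩
  · rintro ⟨φ, hφ⟩
    exact ⟨φ, by rw [godelNumber_eq, hφ, encode_ofNat]⟩

end FormulaLetters

/-! ### Primitive recursiveness relative to finite arity tables -/

/-- The arity oracle read off a finite table (`none` beyond the table). [folklore] -/
def tab (τ : List (Option ℕ)) (i : ℕ) : Option ℕ := τ.getD i none

/-- Reading a table is primitive recursive. [folklore] -/
theorem primrec_tab : Primrec₂ tab := Primrec.list_getD none

/-- `termStep` as an `Option.bind` of arithmetic (for the primitive-recursion proof). [folklore] -/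
theorem termStep_eq (o : ℕ → Option ℕ) (k : ℕ) (s : Option ℕ) (x : ℕ) :
    termStep o k s x = s.bind fun m =>
      if m = 0 then none
      else if x % 4 = 2 ∧ x / 4 < k then some (m - 1)
      else if x % 2 = 1 then (o (x / 2)).map (m - 1 + ·) else none := by
  cases s with
  | none => rfl
  | some m =>
    cases m with
    | zero => rfl
    | succ n => simp [termStep]

section Primrec

open Primrec

/-- `termStep` is primitive recursive in (table, depth, state, letter). [folklore] -/
theorem primrec_termStep :
    Primrec fun q : (List (Option ℕ) × ℕ) × (Option ℕ × ℕ) =>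
      termStep (tab q.1.1) q.1.2 q.2.1 q.2.2 := by
  have hb : Primrec fun p : ((List (Option ℕ) × ℕ) × (Option ℕ × ℕ)) × ℕ =>
      if p.2 = 0 then (none : Option ℕ)
      else if p.1.2.2 % 4 = 2 ∧ p.1.2.2 / 4 < p.1.1.2 then some (p.2 - 1)
      else if p.1.2.2 % 2 = 1 then (tab p.1.1.1 (p.1.2.2 / 2)).map (p.2 - 1 + ·) else none := by
    have hx : Primrec fun p : ((List (Option ℕ) × ℕ) × (Option ℕ × ℕ)) × ℕ => p.1.2.2 :=
      snd.comp (snd.comp fst)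
    have hk : Primrec fun p : ((List (Option ℕ) × ℕ) × (Option ℕ × ℕ)) × ℕ => p.1.1.2 :=
      snd.comp (fst.comp fst)
    have hτ : Primrec fun p : ((List (Option ℕ) × ℕ) × (Option ℕ × ℕ)) × ℕ => p.1.1.1 :=
      fst.comp (fst.comp fst)
    have hm1 : Primrec fun p : ((List (Option ℕ) × ℕ) × (Option ℕ × ℕ)) × ℕ => p.2 - 1 :=
      nat_sub.comp snd (const 1)
    refine ite (PrimrecRel.comp Primrec.eq snd (const 0)) (const none) ?_
    refine ite (PrimrecPred.and (PrimrecRel.comp Primrec.eq (nat_mod.comp hx (const 4)) (const 2))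
      (PrimrecRel.comp nat_lt (nat_div.comp hx (const 4)) hk)) (option_some.comp hm1) ?_
    refine ite (PrimrecRel.comp Primrec.eq (nat_mod.comp hx (const 2)) (const 1)) ?_ (const none)
    exact option_map (primrec_tab.comp hτ (nat_div.comp hx (const 2)))
      (nat_add.comp (hm1.comp fst) snd)
  exact (option_bind (fst.comp snd) hb.to₂).of_eq fun q => by rw [termStep_eq]

/-- `termScan` is primitive recursive in (table, depth, letters, state). [folklore] -/
theorem primrec_termScan :
    Primrec fun q : (List (Option ℕ) × ℕ) × (List ℕ × Option ℕ) =>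
      termScan (tab q.1.1) q.1.2 q.2.1 q.2.2 := by
  have h := list_foldl (σ := Option ℕ) (fst.comp snd) (snd.comp snd)
    (primrec_termStep.comp (Primrec.pair (fst.comp fst) snd)).to₂
    (α := (List (Option ℕ) × ℕ) × (List ℕ × Option ℕ))
  exact h.of_eq fun q => rfl

/-- `isTermAtB` is primitive recursive in (table, depth, letter). [folklore] -/
theorem primrec_isTermAtB :
    Primrec fun q : List (Option ℕ) × ℕ × ℕ => isTermAtB (tab q.1) q.2.1 q.2.2 := by
  have hx : Primrec fun q : List (Option ℕ) × ℕ × ℕ => q.2.2 := snd.comp snd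
  have hk : Primrec fun q : List (Option ℕ) × ℕ × ℕ => q.2.1 := fst.comp snd
  have h1 : PrimrecPred fun q : List (Option ℕ) × ℕ × ℕ => q.2.2 % 2 = 0 :=
    PrimrecRel.comp Primrec.eq (nat_mod.comp hx (const 2)) (const 0)
  have h2 : PrimrecPred fun q : List (Option ℕ) × ℕ × ℕ => (q.2.2 / 2).unpair.1 = q.2.1 :=
    PrimrecRel.comp Primrec.eq (fst.comp (unpair.comp (nat_div.comp hx (const 2)))) hk
  have h3 : PrimrecPred fun q : List (Option ℕ) × ℕ × ℕ =>
      termScan (tab q.1) q.2.1 (ofNat (List ℕ) (q.2.2 / 2).unpair.2) (some 1) = some 0 :=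
    PrimrecRel.comp Primrec.eq
      (primrec_termScan.comp (Primrec.pair (Primrec.pair fst hk)
        (Primrec.pair ((Primrec.ofNat (List ℕ)).comp
          (snd.comp (unpair.comp (nat_div.comp hx (const 2))))) (const (some 1)))))
      (const (some 0))
  exact ((Primrec.and.comp (Primrec.and.comp h1.decide h2.decide) h3.decide).of_eq
    fun q => rfl)

/-- `allTermAtB` is primitive recursive in (table, depth, letters). [folklore] -/
theorem primrec_allTermAtB :
    Primrec fun q : List (Option ℕ) × ℕ × List ℕ => allTermAtB (tab q.1) q.2.1 q.2.2 := by
  have h := list_foldl (σ := Bool) (snd.comp snd) (const true)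
    (Primrec.and.comp (fst.comp snd) (primrec_isTermAtB.comp
      (Primrec.pair (fst.comp fst) (Primrec.pair (fst.comp (snd.comp fst)) (snd.comp snd))))).to₂
    (α := List (Option ℕ) × ℕ × List ℕ)
  exact h.of_eq fun q => rfl

end Primrec

/-! ### The recogniser is primitive recursive (course-of-values recursion on the fuel) -/

/-- Arguments of the table-relative recogniser: `(τF, τR, fuel, depth, letters)`. [folklore] -/
abbrev PArg : Type := List (Option ℕ) × List (Option ℕ) × ℕ × ℕ × List ℕ

/-- The table-relative recogniser as a unary function. [folklore] -/
def pF (b : PArg) : Option (List ℕ) := parseF (tab b.1) (tab b.2.1) b.2.2.1 b.2.2.2.1 b.2.2.2.2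

/-- One step of the recogniser at a letter `x` with tail `t`, given the list `res` of results of
the candidate recursive calls `pCalls` (same order). [folklore] -/
def pStep (τF τR : List (Option ℕ)) (k x : ℕ) (t : List ℕ) (res : List (Option (List ℕ))) :
    Option (List ℕ) :=
  if x = 4 * k + 11 then some t
  else if x = 3 then
    ((res[0]?).getD none).bind fun m => (res[t.length - m.length + 2]?).getD none
  else if x = 7 then (res[1]?).getD none
  else if x % 2 = 0 then
    match t with
    | [] => none
    | y :: t' =>
      if isTermAtB (tab τF) k x = true ∧ isTermAtB (tab τF) k y = true then some t' else none
  else if x % 4 = 1 then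
    (tab τR (x / 4)).bind fun a =>
      match t with
      | [] => none
      | y :: t' =>
        if y = 4 * k + 3 ∧ a ≤ t'.length ∧ allTermAtB (tab τF) k (t'.take a) = true then
          some (t'.drop a) else none
  else none

/-- The candidate recursive calls at `(τF, τR, f + 1, k, x :: t)`: `(f, k, t)`, `(f, k + 1, t)`,
and `(f, k, t.drop j)` for `j ≤ t.length` (an over-approximation of the data-dependent second
call of the implication case). [folklore] -/
def pCalls (b : PArg) : List PArg :=
  if b.2.2.1 = 0 then [] else
    (b.1, b.2.1, b.2.2.1 - 1, b.2.2.2.1, b.2.2.2.2.tail) ::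
    (b.1, b.2.1, b.2.2.1 - 1, b.2.2.2.1 + 1, b.2.2.2.2.tail) ::
    (List.range (b.2.2.2.2.tail.length + 1)).map fun j =>
      (b.1, b.2.1, b.2.2.1 - 1, b.2.2.2.1, b.2.2.2.2.tail.drop j)

/-- The step function of the course-of-values recursion. [folklore] -/
def pG (b : PArg) (res : List (Option (List ℕ))) : Option (Option (List ℕ)) :=
  if b.2.2.1 = 0 ∨ b.2.2.2.2 = [] then some none
  else some (pStep b.1 b.2.1 b.2.2.2.1 b.2.2.2.2.headI b.2.2.2.2.tail res)

/-- The candidate recursive calls have less fuel. [folklore] -/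
theorem pCalls_lt (b : PArg) : ∀ b' ∈ pCalls b, b'.2.2.1 < b.2.2.1 := by
  intro b' hb'
  unfold pCalls at hb'
  split_ifs at hb' with h
  · simp at hb'
  · simp only [List.mem_cons, List.mem_map, List.mem_range] at hb'
    rcases hb' with rfl | rfl | ⟨j, -, rfl⟩ <;> simp <;> omega

/-- The step function computes the recogniser from the results of the candidate calls. [folklore] -/
theorem pG_pCalls (b : PArg) : pG b ((pCalls b).map pF) = some (pF b) := by
  obtain ⟨τF, τR, f, k, l⟩ := b
  cases f with
  | zero => simp [pG, pF]
  | succ f =>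
    cases l with
    | nil => simp [pG, pF]
    | cons x t =>
      simp only [pG, pF, Nat.add_eq_zero_iff, one_ne_zero, and_false, reduceCtorEq, or_self,
        if_false, List.headI_cons, List.tail_cons]
      congr 1
      -- the results of the candidate calls
      set res := (pCalls (τF, τR, f + 1, k, x :: t)).map pF with hres
      have hres' : res = pF (τF, τR, f, k, t) :: pF (τF, τR, f, k + 1, t) ::
          (List.range (t.length + 1)).map (fun j => pF (τF, τR, f, k, t.drop j)) := by
        simp [hres, pCalls, Function.comp_def]
      have h0 : (res[0]?).getD none = parseF (tab τF) (tab τR) f k t := by simp [hres', pF]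
      have h1 : (res[1]?).getD none = parseF (tab τF) (tab τR) f (k + 1) t := by simp [hres', pF]
      have h2 : ∀ m, parseF (tab τF) (tab τR) f k t = some m →
          (res[t.length - m.length + 2]?).getD none = parseF (tab τF) (tab τR) f k m := by
        intro m hm
        obtain ⟨p, rfl⟩ := suffix_of_parseF _ _ _ _ hm
        have hj : (p ++ m).length - m.length < (p ++ m).length + 1 := by omega
        rw [hres', List.getElem?_cons_succ, List.getElem?_cons_succ, List.getElem?_map,
          List.getElem?_range hj]
        simp [pF, drop_append_of_length_eq m rfl]
      rw [parseF_succ_cons, pStep.eq_def, h0, h1]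
      cases hp : parseF (tab τF) (tab τR) f k t with
      | none => rfl
      | some m => simp only [Option.bind_some, h2 m hp]

section Primrec

open Primrec

/-- `pCalls` is primitive recursive. [folklore] -/
theorem primrec_pCalls : Primrec pCalls := by
  have hτF : Primrec fun b : PArg => b.1 := fst
  have hτR : Primrec fun b : PArg => b.2.1 := fst.comp snd
  have hf : Primrec fun b : PArg => b.2.2.1 - 1 := nat_sub.comp (fst.comp (snd.comp snd)) (const 1)
  have hk : Primrec fun b : PArg => b.2.2.2.1 := fst.comp (snd.comp (snd.comp snd))
  have ht : Primrec fun b : PArg => b.2.2.2.2.tail :=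
    list_tail.comp (snd.comp (snd.comp (snd.comp snd)))
  refine ite (PrimrecRel.comp Primrec.eq (fst.comp (snd.comp snd)) (const 0)) (const []) ?_
  refine list_cons.comp (hτF.pair (hτR.pair (hf.pair (hk.pair ht)))) ?_
  refine list_cons.comp (hτF.pair (hτR.pair (hf.pair ((succ.comp hk).pair ht)))) ?_
  refine list_map (list_range.comp (succ.comp (list_length.comp ht))) ?_
  exact (hτF.comp fst).pair ((hτR.comp fst).pair ((hf.comp fst).pair ((hk.comp fst).pair
    (list_drop.comp snd (ht.comp fst)))))

/-- The implication branch of `pStep` is primitive recursive in `(t, res)`. [folklore] -/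
theorem primrec_impCase :
    Primrec fun q : List ℕ × List (Option (List ℕ)) =>
      ((q.2[0]?).getD none).bind fun m => (q.2[q.1.length - m.length + 2]?).getD none := by
  refine option_bind (option_getD.comp (list_getElem?.comp snd (const 0))
    (const (none : Option (List ℕ)))) ?_
  exact option_getD.comp (list_getElem?.comp (snd.comp fst) (nat_add.comp
    (nat_sub.comp (list_length.comp (fst.comp fst)) (list_length.comp snd)) (const 2)))
    (const (none : Option (List ℕ)))

/-- The equation branch of `pStep` (curried for `Primrec.list_casesOn`). [folklore] -/
def eqCase (q : PArg × List (Option (List ℕ))) (p : ℕ × List ℕ) : Option (List ℕ) :=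
  if isTermAtB (tab q.1.1) q.1.2.2.1 q.1.2.2.2.1 = true ∧ isTermAtB (tab q.1.1) q.1.2.2.1 p.1 = true
  then some p.2 else none

/-- The relation branch of `pStep`, inner part (curried for `Primrec.list_casesOn`). [folklore] -/
def relCase (q : (PArg × List (Option (List ℕ))) × ℕ) (p : ℕ × List ℕ) : Option (List ℕ) :=
  if p.1 = 4 * q.1.1.2.2.1 + 3 ∧ q.2 ≤ p.2.length ∧
      allTermAtB (tab q.1.1.1) q.1.1.2.2.1 (p.2.take q.2) = true then
    some (p.2.drop q.2) else none

/-- The relation branch of `pStep`, as a function of the arity `a` (curried for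
`Primrec.option_bind`). [folklore] -/
def relBind (q : PArg × List (Option (List ℕ))) (a : ℕ) : Option (List ℕ) :=
  List.casesOn (motive := fun _ => Option (List ℕ)) q.1.2.2.2.2 none fun y t' => relCase (q, a) (y, t')

/-- `eqCase` is primitive recursive. [folklore] -/
theorem primrec_eqCase : Primrec₂ eqCase := by
  have h1' := primrec_isTermAtB.comp ((fst.comp (fst.comp fst)).pair
      ((fst.comp (snd.comp (snd.comp (fst.comp fst)))).pair
        (fst.comp (snd.comp (snd.comp (snd.comp (fst.comp fst)))))))
      (α := (PArg × List (Option (List ℕ))) × (ℕ × List ℕ))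
  have h1 : PrimrecPred fun q : (PArg × List (Option (List ℕ))) × (ℕ × List ℕ) =>
      isTermAtB (tab q.1.1.1) q.1.1.2.2.1 q.1.1.2.2.2.1 = true :=
    PrimrecRel.comp Primrec.eq h1' (const true)
  have h2' := primrec_isTermAtB.comp ((fst.comp (fst.comp fst)).pair
      ((fst.comp (snd.comp (snd.comp (fst.comp fst)))).pair (fst.comp snd)))
      (α := (PArg × List (Option (List ℕ))) × (ℕ × List ℕ))
  have h2 : PrimrecPred fun q : (PArg × List (Option (List ℕ))) × (ℕ × List ℕ) =>
      isTermAtB (tab q.1.1.1) q.1.1.2.2.1 q.2.1 = true :=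
    PrimrecRel.comp Primrec.eq h2' (const true)
  exact ite (h1.and h2) (option_some.comp (snd.comp snd)) (const none)

/-- `relCase` is primitive recursive. [folklore] -/
theorem primrec_relCase : Primrec₂ relCase := by
  have hk : Primrec fun q : ((PArg × List (Option (List ℕ))) × ℕ) × (ℕ × List ℕ) =>
      q.1.1.1.2.2.1 := fst.comp (snd.comp (snd.comp (fst.comp (fst.comp fst))))
  have hτ : Primrec fun q : ((PArg × List (Option (List ℕ))) × ℕ) × (ℕ × List ℕ) =>
      q.1.1.1.1 := fst.comp (fst.comp (fst.comp fst))
  have ha : Primrec fun q : ((PArg × List (Option (List ℕ))) × ℕ) × (ℕ × List ℕ) => q.1.2 :=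
    snd.comp fst
  have ht : Primrec fun q : ((PArg × List (Option (List ℕ))) × ℕ) × (ℕ × List ℕ) => q.2.2 :=
    snd.comp snd
  have h1 : PrimrecPred fun q : ((PArg × List (Option (List ℕ))) × ℕ) × (ℕ × List ℕ) =>
      q.2.1 = 4 * q.1.1.1.2.2.1 + 3 :=
    PrimrecRel.comp Primrec.eq (fst.comp snd) (nat_add.comp (nat_mul.comp (const 4) hk) (const 3))
  have h2 : PrimrecPred fun q : ((PArg × List (Option (List ℕ))) × ℕ) × (ℕ × List ℕ) =>
      q.1.2 ≤ q.2.2.length :=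
    PrimrecRel.comp nat_le ha (list_length.comp ht)
  -- (the composition is bound first: elaborating it against the expected type is a costly
  -- higher-order unification)
  have h3' := primrec_allTermAtB.comp (hτ.pair (hk.pair (list_take.comp ha ht)))
  have h3 : PrimrecPred fun q : ((PArg × List (Option (List ℕ))) × ℕ) × (ℕ × List ℕ) =>
      allTermAtB (tab q.1.1.1.1) q.1.1.1.2.2.1 (q.2.2.take q.1.2) = true :=
    PrimrecRel.comp Primrec.eq h3' (const true)
  exact ite (h1.and (h2.and h3)) (option_some.comp (list_drop.comp ha ht)) (const none)

/-- `relBind` is primitive recursive. [folklore] -/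
theorem primrec_relBind : Primrec₂ relBind :=
  list_casesOn (snd.comp (snd.comp (snd.comp (snd.comp (fst.comp fst))))) (const none)
    primrec_relCase

/-- `pStep` is primitive recursive in `((τF, τR, k, x, t), res)`. [folklore] -/
theorem primrec_pStep :
    Primrec fun q : PArg × List (Option (List ℕ)) =>
      pStep q.1.1 q.1.2.1 q.1.2.2.1 q.1.2.2.2.1 q.1.2.2.2.2 q.2 := by
  have hτR : Primrec fun q : PArg × List (Option (List ℕ)) => q.1.2.1 := fst.comp (snd.comp fst)
  have hk : Primrec fun q : PArg × List (Option (List ℕ)) => q.1.2.2.1 :=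
    fst.comp (snd.comp (snd.comp fst))
  have hx : Primrec fun q : PArg × List (Option (List ℕ)) => q.1.2.2.2.1 :=
    fst.comp (snd.comp (snd.comp (snd.comp fst)))
  have ht : Primrec fun q : PArg × List (Option (List ℕ)) => q.1.2.2.2.2 :=
    snd.comp (snd.comp (snd.comp (snd.comp fst)))
  have hres : Primrec fun q : PArg × List (Option (List ℕ)) => q.2 := snd
  have hP : Primrec fun q : PArg × List (Option (List ℕ)) =>
      if q.1.2.2.2.1 = 4 * q.1.2.2.1 + 11 then some q.1.2.2.2.2
      else if q.1.2.2.2.1 = 3 then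
        ((q.2[0]?).getD none).bind fun m => (q.2[q.1.2.2.2.2.length - m.length + 2]?).getD none
      else if q.1.2.2.2.1 = 7 then (q.2[1]?).getD none
      else if q.1.2.2.2.1 % 2 = 0 then
        List.casesOn (motive := fun _ => Option (List ℕ)) q.1.2.2.2.2 none fun y t' =>
          eqCase q (y, t')
      else if q.1.2.2.2.1 % 4 = 1 then (tab q.1.2.1 (q.1.2.2.2.1 / 4)).bind (relBind q)
      else none := by
    refine ite (PrimrecRel.comp Primrec.eq hx (nat_add.comp (nat_mul.comp (const 4) hk) (const 11)))
      (option_some.comp ht) ?_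
    refine ite (PrimrecRel.comp Primrec.eq hx (const 3)) (primrec_impCase.comp (ht.pair hres)) ?_
    refine ite (PrimrecRel.comp Primrec.eq hx (const 7))
      (option_getD.comp (list_getElem?.comp hres (const 1)) (const none)) ?_
    refine ite (PrimrecRel.comp Primrec.eq (nat_mod.comp hx (const 2)) (const 0))
      (list_casesOn ht (const none) primrec_eqCase) ?_
    exact ite (PrimrecRel.comp Primrec.eq (nat_mod.comp hx (const 4)) (const 1))
      (option_bind (primrec_tab.comp hτR (nat_div.comp hx (const 4))) primrec_relBind) (const none)
  refine hP.of_eq fun q => ?_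
  obtain ⟨⟨τF, τR, k, x, t⟩, res⟩ := q
  cases t <;> rfl

/-- `pG` is primitive recursive. [folklore] -/
theorem primrec_pG : Primrec₂ pG := by
  have hf : Primrec fun q : PArg × List (Option (List ℕ)) => q.1.2.2.1 :=
    fst.comp (snd.comp (snd.comp fst))
  have hl : Primrec fun q : PArg × List (Option (List ℕ)) => q.1.2.2.2.2 :=
    snd.comp (snd.comp (snd.comp (snd.comp fst)))
  have hS : Primrec fun q : PArg × List (Option (List ℕ)) =>
      pStep q.1.1 q.1.2.1 q.1.2.2.2.1 q.1.2.2.2.2.headI q.1.2.2.2.2.tail q.2 :=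
    primrec_pStep.comp (((fst.comp fst).pair ((fst.comp (snd.comp fst)).pair
      ((fst.comp (snd.comp (snd.comp (snd.comp fst)))).pair ((list_headI.comp hl).pair
        (list_tail.comp hl))))).pair snd)
  exact (ite (PrimrecPred.or (PrimrecRel.comp Primrec.eq hf (const 0))
    (PrimrecRel.comp Primrec.eq hl (const []))) (const (some none)) (option_some.comp hS)).to₂

/-- **The table-relative recogniser is primitive recursive.** [folklore] -/
theorem primrec_pF : Primrec pF :=
  nat_omega_rec' pF (fst.comp (snd.comp snd)) primrec_pCalls primrec_pG pCalls_lt pG_pCalls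

/-- The table-relative sentence recogniser is primitive recursive in `(τF, τR, letters)`. [folklore] -/
theorem primrec_sentenceLettersB :
    Primrec fun q : List (Option ℕ) × List (Option ℕ) × List ℕ =>
      sentenceLettersB (tab q.1) (tab q.2.1) q.2.2 := by
  have h : PrimrecPred fun q : List (Option ℕ) × List (Option ℕ) × List ℕ =>
      pF (q.1, q.2.1, q.2.2.length + 1, 0, q.2.2) = some [] :=
    PrimrecRel.comp Primrec.eq (primrec_pF.comp (fst.pair ((fst.comp snd).pair
      ((succ.comp (list_length.comp (snd.comp snd))).pair ((const 0).pair (snd.comp snd))))))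
      (const (some []))
  exact h.decide.of_eq fun q => rfl

end Primrec

/-! ### Changing the oracles below a bound does not change the recognisers -/

section Congr

variable {o o' oF oF' oR oR' : ℕ → Option ℕ} {B k : ℕ}

/-- `termStep` only consults the oracle below the letter. [folklore] -/
theorem termStep_congr (ho : ∀ i < B, o i = o' i) {x : ℕ} (hx : x < B) (s : Option ℕ) :
    termStep o k s x = termStep o' k s x := by
  rw [termStep_eq, termStep_eq, ho (x / 2) (by omega)]

/-- `termScan` only consults the oracle below the letters. [folklore] -/
theorem termScan_congr (ho : ∀ i < B, o i = o' i) :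
    ∀ (l : List ℕ), (∀ x ∈ l, x < B) → ∀ s, termScan o k l s = termScan o' k l s
  | [], _, _ => rfl
  | x :: l, hl, s => by
    rw [termScan_cons, termScan_cons, termStep_congr ho (hl x List.mem_cons_self) s]
    exact termScan_congr ho l (fun z hz => hl z (List.mem_cons_of_mem _ hz)) _

/-- `isTermAtB` only consults the oracle below the letter. [folklore] -/
theorem isTermAtB_congr (ho : ∀ i < B, o i = o' i) {x : ℕ} (hx : x < B) :
    isTermAtB o k x = isTermAtB o' k x := by
  unfold isTermAtB
  rw [termScan_congr ho _ (fun y hy => ?_)]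
  have h1 := lt_of_mem_ofNat hy
  have h2 := Nat.unpair_right_le (x / 2)
  omega

/-- `allTermAtB` only consults the oracle below the letters. [folklore] -/
theorem allTermAtB_congr (ho : ∀ i < B, o i = o' i) {l : List ℕ} (hl : ∀ x ∈ l, x < B) :
    allTermAtB o k l = allTermAtB o' k l := by
  rw [Bool.eq_iff_iff, allTermAtB_eq_true, allTermAtB_eq_true]
  constructor
  · intro h z hz; rw [← isTermAtB_congr ho (hl z hz)]; exact h z hz
  · intro h z hz; rw [isTermAtB_congr ho (hl z hz)]; exact h z hz

/-- The recogniser only consults the oracles below the letters. [folklore] -/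
theorem parseF_congr (hoF : ∀ i < B, oF i = oF' i) (hoR : ∀ i < B, oR i = oR' i) :
    ∀ (f k : ℕ) (l : List ℕ), (∀ x ∈ l, x < B) → parseF oF oR f k l = parseF oF' oR' f k l := by
  intro f
  induction f with
  | zero => intros; rfl
  | succ f ih =>
    intro k l hl
    cases l with
    | nil => simp
    | cons x t =>
      have hx : x < B := hl x List.mem_cons_self
      have ht : ∀ z ∈ t, z < B := fun z hz => hl z (List.mem_cons_of_mem _ hz)
      have hbind : ((parseF oF' oR' f k t).bind fun m => parseF oF oR f k m) =
          (parseF oF' oR' f k t).bind fun m => parseF oF' oR' f k m := by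
        cases hp : parseF oF' oR' f k t with
        | none => rfl
        | some m =>
          simp only [Option.bind_some]
          exact ih k m fun z hz => ht z ((suffix_of_parseF _ _ _ _ hp).subset hz)
      rw [parseF_succ_cons, parseF_succ_cons, ih k t ht, ih (k + 1) t ht, hbind,
        hoR (x / 4) (by omega), isTermAtB_congr hoF hx]
      cases t with
      | nil => rfl
      | cons y t' =>
        have hy : y < B := ht y List.mem_cons_self
        have ht' : ∀ z ∈ t', z < B := fun z hz => ht z (List.mem_cons_of_mem _ hz)
        have hall : ∀ a, allTermAtB oF k (t'.take a) = allTermAtB oF' k (t'.take a) := fun a =>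
          allTermAtB_congr hoF fun z hz => ht' z (List.take_subset _ _ hz)
        simp only [isTermAtB_congr hoF hy, hall]

/-- The sentence recogniser only consults the oracles below the letters. [folklore] -/
theorem sentenceLettersB_congr (hoF : ∀ i < B, oF i = oF' i) (hoR : ∀ i < B, oR i = oR' i)
    {l : List ℕ} (hl : ∀ x ∈ l, x < B) :
    sentenceLettersB oF oR l = sentenceLettersB oF' oR' l := by
  unfold sentenceLettersB
  rw [parseF_congr hoF hoR _ _ _ hl]

end Congr

/-! ### Tabulating computable arity oracles; the decision procedure -/

/-- The finite table `[ar 0, …, ar (n - 1)]` of an arity function. [folklore] -/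
def arityTable (ar : ℕ → Option ℕ) (n : ℕ) : List (Option ℕ) :=
  Nat.rec [] (fun i acc => acc ++ [ar i]) n

section Table

variable {ar : ℕ → Option ℕ}

/-- The empty table. [folklore] -/
theorem arityTable_zero : arityTable ar 0 = [] := rfl

/-- Extending the table by one entry. [folklore] -/
theorem arityTable_succ (n : ℕ) : arityTable ar (n + 1) = arityTable ar n ++ [ar n] := rfl

/-- The table below `n` has length `n`. [folklore] -/
@[simp] theorem length_arityTable (n : ℕ) : (arityTable ar n).length = n := by
  induction n with
  | zero => rfl
  | succ n ih => rw [arityTable_succ, List.length_append, ih, List.length_singleton]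

/-- The entries of the table. [folklore] -/
theorem getElem?_arityTable {i n : ℕ} (h : i < n) : (arityTable ar n)[i]? = some (ar i) := by
  induction n with
  | zero => omega
  | succ n ih =>
    rw [arityTable_succ]
    rcases Nat.lt_succ_iff_lt_or_eq.1 h with h | rfl
    · rw [List.getElem?_append_left (by rw [length_arityTable]; exact h), ih h]
    · rw [List.getElem?_append_right (by rw [length_arityTable]), length_arityTable, Nat.sub_self]
      rfl

/-- Below `n`, the oracle read off the table is the arity function. [folklore] -/
theorem tab_arityTable_of_lt {i n : ℕ} (h : i < n) : tab (arityTable ar n) i = ar i := by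
  rw [tab, List.getD_eq_getElem?_getD, getElem?_arityTable h, Option.getD_some]

/-- The table of a computable arity function is computable. [folklore] -/
theorem computable_arityTable (har : Computable ar) : Computable (arityTable ar) := by
  have hh : Computable₂ fun (_ : ℕ) (p : ℕ × List (Option ℕ)) => p.2 ++ [ar p.1] :=
    Computable.list_concat.comp (Computable.snd.comp Computable.snd)
      (har.comp (Computable.fst.comp Computable.snd))
  exact (Computable.nat_rec Computable.id (Computable.const []) hh).of_eq fun n => rfl

end Table

section Decide

variable {L : Language} [Encodable (Σ i, L.Functions i)] [Encodable (Σ i, L.Relations i)]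

/-- **The recogniser with computable oracles is computable** (oracles are tabulated below the
input, which bounds every symbol consulted). [folklore] -/
theorem computable_sentenceLettersB {arF arR : ℕ → Option ℕ} (hF : Computable arF)
    (hR : Computable arR) :
    Computable fun n : ℕ => sentenceLettersB arF arR (ofNat (List ℕ) n) := by
  have h1 : Computable fun n : ℕ => sentenceLettersB (tab (arityTable arF (n + 1)))
      (tab (arityTable arR (n + 1))) (ofNat (List ℕ) n) :=
    primrec_sentenceLettersB.to_comp.comp (((computable_arityTable hF).comp Computable.succ).pair
      (((computable_arityTable hR).comp Computable.succ).pair (Computable.ofNat _)))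
  refine h1.of_eq fun n => ?_
  exact sentenceLettersB_congr (B := n + 1) (fun i hi => tab_arityTable_of_lt hi)
    (fun i hi => tab_arityTable_of_lt hi) (fun x hx => Nat.lt_succ_of_lt (lt_of_mem_ofNat hx))

/-- **The set of Gödel numbers of sentences is decidable**, for a language whose arity tables
(`arityF`, `arityR`: the arity of a symbol read off its code, `none` off the code set) are
computable — in particular for every recursively presented language (Enderton, *A Mathematical
Introduction to Logic*, §3.4, item 6: "the set of sentences is recursive"). [cite: Enderton2001, §3.4] -/
theorem computablePred_exists_godelNumber_eq (hF : Computable (arityF L))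
    (hR : Computable (arityR L)) :
    ComputablePred fun n : ℕ => ∃ φ : L.Sentence, φ.godelNumber = n :=
  ComputablePred.computable_iff.2 ⟨_, computable_sentenceLettersB hF hR,
    funext fun n => propext (exists_godelNumber_eq_iff n)⟩

end Decide

end Literature.ModelTheory.ProofTheory.PreFOL
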